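import Mathlib.Algebra.MvPolynomial.SchwartzZippel
import Literature.RingTheory.MvPolynomial.KaltofenEffectiveBertiniProofs
import Literature.NumberTheory.DiophantineGeometry.PlaneSectionCountingProofs
import HarnessLib

/-!
# Counting the plane sections that are not absolutely irreducible (Cafure–Matera 2006, Cor. 3.2)

Library file (theorems only). Let `K = 𝔽_q` and `f ∈ K[x₀, …, xₙ]` (`n ≥ 1`) be absolutely
irreducible of total degree `δ ≥ 2`. By Kaltofen's effective first Bertini theorem, now a theorem of
the tree (`Literature.RingTheory.MvPolynomial.kaltofen1995_effectiveBertini_holds`), there are a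
nonzero `Υ ∈ K[v, w]` of degree `≤ 2δ²` and, for each `(ν, ω)` with `Υ(ν, ω) ≠ 0`, a nonzero
`Ψ ∈ K̄[z]` with `2 deg Ψ + 4δ³ ≤ 3δ⁴ + δ²` such that the plane section
`f_{ν,ω,η} = f(X + ν₀, ωᵢX + ηᵢY + ν_{i+1})` is absolutely irreducible whenever `Ψ(η) ≠ 0`.
Counting the zeros of `Υ` in `K^{2n+1}` and of each `Ψ` in `Kⁿ ⊆ K̄ⁿ` by the Schwartz–Zippel
lemma (Cafure–Matera's Lemma 2.1) gives **Cafure–Matera's Corollary 3.2**: the number `B` of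
parameters `(ν, ω, η) ∈ K^{n+1} × Kⁿ × Kⁿ` whose plane section is not absolutely irreducible
satisfies `2B + 4δ³ q^{3n} ≤ (3δ⁴ + 5δ²) q^{3n}`, i.e. `B ≤ (3δ⁴/2 - 2δ³ + 5δ²/2) q^{3n}`
(`two_mul_card_filter_not_irreducible_planeSection_add_le`).

## References

* A. Cafure, G. Matera, *Improved explicit estimates on the number of solutions of equations over a
  finite field*, Finite Fields Appl. 12 (2006) 155–185, Lemma 2.1, §3.2, Cor. 3.2. [CafureMatera2006]
* E. Kaltofen, *Effective Noether irreducibility forms and applications*, J. Comput. System Sci. 50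
  (1995) 274–295, Lemma 4, Thm. 5. [Kaltofen1995]
-/

noncomputable section

open MvPolynomial Literature.RingTheory.MvPolynomial

namespace Literature.NumberTheory.DiophantineGeometry

universe u

variable {K : Type u} [Field K] [Fintype K] [DecidableEq K]

/-! ### Schwartz–Zippel counts -/

omit [DecidableEq K] in
/-- **Zeros in `Kᵐ` of a nonzero polynomial with coefficients in an extension** (Schwartz–Zippel,
Cafure–Matera's Lemma 2.1): a nonzero `Ψ ∈ L[z₁, …, z_m]` (`m ≥ 1`) vanishes at no more than
`deg Ψ · q^{m-1}` points of `Kᵐ`. [cite: CafureMatera2006, Lemma 2.1] -/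
theorem card_filter_eval_comp_eq_zero_le {L : Type*} [CommRing L] [IsDomain L] [DecidableEq L]
    [Algebra K L] {m : ℕ} (hm : 1 ≤ m) {Ψ : MvPolynomial (Fin m) L} (hΨ : Ψ ≠ 0) :
    ((Finset.univ : Finset (Fin m → K)).filter
        fun η ↦ MvPolynomial.eval (algebraMap K L ∘ η) Ψ = 0).card ≤
      Ψ.totalDegree * Fintype.card K ^ (m - 1) := by
  classical
  set ι : K →+* L := algebraMap K L with hι
  set S : Finset L := (Finset.univ : Finset K).image ι with hS
  have hScard : S.card = Fintype.card K := by
    rw [hS, Finset.card_image_of_injective _ ι.injective, Finset.card_univ]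
  -- identify the `K`-points with the points of `Sᵐ`
  have hcount : ((Finset.univ : Finset (Fin m → K)).filter
      fun η ↦ MvPolynomial.eval (ι ∘ η) Ψ = 0).card =
      ((Fintype.piFinset fun _ : Fin m ↦ S).filter fun x ↦ MvPolynomial.eval x Ψ = 0).card := by
    refine Finset.card_bij (fun η _ ↦ ι ∘ η) (fun η hη ↦ ?_) (fun η₁ _ η₂ _ h ↦ ?_) (fun x hx ↦ ?_)
    · rw [Finset.mem_filter] at hη ⊢
      refine ⟨Fintype.mem_piFinset.2 fun i ↦ ?_, hη.2⟩
      rw [hS, Finset.mem_image]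
      exact ⟨η i, Finset.mem_univ _, rfl⟩
    · funext i
      exact ι.injective (congr_fun h i)
    · rw [Finset.mem_filter] at hx
      have hx1 := Fintype.mem_piFinset.1 hx.1
      choose η hη using fun i ↦ Finset.mem_image.1 (by rw [hS] at hx1; exact hx1 i)
      refine ⟨η, ?_, ?_⟩
      · rw [Finset.mem_filter]
        refine ⟨Finset.mem_univ _, ?_⟩
        have : ι ∘ η = x := funext fun i ↦ (hη i).2
        rw [this]; exact hx.2
      · exact funext fun i ↦ (hη i).2
  rw [hcount]
  -- Schwartz–Zippel over `L`
  have hSZ := MvPolynomial.schwartz_zippel_totalDegree hΨ S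
  rw [hScard] at hSZ
  have hq : (0 : NNRat) < Fintype.card K := by exact_mod_cast Fintype.card_pos
  rw [div_le_div_iff₀ (by positivity) hq] at hSZ
  obtain ⟨m', rfl⟩ : ∃ m', m = m' + 1 := ⟨m - 1, by omega⟩
  have h2 : ((((Fintype.piFinset fun _ : Fin (m' + 1) ↦ S).filter
      fun x ↦ MvPolynomial.eval x Ψ = 0).card : ℕ) : NNRat) * Fintype.card K ≤
      ((Ψ.totalDegree * Fintype.card K ^ m' : ℕ) : NNRat) * Fintype.card K := by
    calc _ ≤ (Ψ.totalDegree : NNRat) * (Fintype.card K : NNRat) ^ (m' + 1) := hSZ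
      _ = ((Ψ.totalDegree * Fintype.card K ^ m' : ℕ) : NNRat) * Fintype.card K := by
        push_cast; ring
  have h3 := le_of_mul_le_mul_right h2 hq
  rw [Nat.add_sub_cancel]
  exact_mod_cast h3

/-- **Zeros in `K^{n+1} × Kⁿ` of a nonzero `Υ ∈ K[v₀, …, vₙ, w₁, …, wₙ]`** (Schwartz–Zippel after
renaming the variables to `Fin (2n+1)`): at most `deg Υ · q^{2n}`.
[cite: CafureMatera2006, Lemma 2.1] -/
theorem card_filter_eval_sumElim_eq_zero_le {n : ℕ} {Υ : MvPolynomial (Fin (n + 1) ⊕ Fin n) K}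
    (hΥ : Υ ≠ 0) :
    ((Finset.univ : Finset ((Fin (n + 1) → K) × (Fin n → K))).filter
        fun p ↦ MvPolynomial.eval (Sum.elim p.1 p.2) Υ = 0).card ≤
      Υ.totalDegree * Fintype.card K ^ (2 * n) := by
  classical
  set e : Fin (n + 1) ⊕ Fin n ≃ Fin (n + 1 + n) := finSumFinEquiv with he
  set Υ' : MvPolynomial (Fin (n + 1 + n)) K := rename e Υ with hΥ'
  have hΥ'0 : Υ' ≠ 0 := fun h ↦ hΥ (rename_injective e e.injective (by rw [← hΥ', h, map_zero]))
  have hdeg : Υ'.totalDegree = Υ.totalDegree := totalDegree_renameEquiv e Υ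
  have hcount : ((Finset.univ : Finset ((Fin (n + 1) → K) × (Fin n → K))).filter
      fun p ↦ MvPolynomial.eval (Sum.elim p.1 p.2) Υ = 0).card = rationalPointCount Υ' := by
    unfold rationalPointCount
    refine Finset.card_bij (fun p _ ↦ Sum.elim p.1 p.2 ∘ e.symm) (fun p hp ↦ ?_)
      (fun p₁ _ p₂ _ h ↦ ?_) (fun y hy ↦ ?_)
    · rw [Finset.mem_filter] at hp ⊢
      refine ⟨Finset.mem_univ _, ?_⟩
      rw [hΥ', eval_rename, Function.comp_assoc, Equiv.symm_comp_self, Function.comp_id]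
      exact hp.2
    · have h' : Sum.elim p₁.1 p₁.2 = Sum.elim p₂.1 p₂.2 := by
        have := congrArg (fun g ↦ g ∘ e) h
        simpa [Function.comp_assoc] using this
      exact Prod.ext (funext fun i ↦ congr_fun h' (Sum.inl i)) (funext fun i ↦ congr_fun h' (Sum.inr i))
    · refine ⟨(y ∘ e ∘ Sum.inl, y ∘ e ∘ Sum.inr), ?_, ?_⟩
      · rw [Finset.mem_filter] at hy ⊢
        refine ⟨Finset.mem_univ _, ?_⟩
        rw [hΥ', eval_rename] at hy
        have hpt : Sum.elim (y ∘ e ∘ Sum.inl) (y ∘ e ∘ Sum.inr) = y ∘ e := by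
          funext i
          rcases i with i | i <;> rfl
        change MvPolynomial.eval (Sum.elim (y ∘ e ∘ Sum.inl) (y ∘ e ∘ Sum.inr)) Υ = 0
        rw [hpt]
        exact hy.2
      · funext j
        simp only [Function.comp_apply]
        rcases h : e.symm j with i | i
        · simp only [Sum.elim_inl, Function.comp_apply]
          rw [← h, Equiv.apply_symm_apply]
        · simp only [Sum.elim_inr, Function.comp_apply]
          rw [← h, Equiv.apply_symm_apply]
  rw [hcount, ← hdeg]
  calc rationalPointCount Υ' ≤ Υ'.totalDegree * Fintype.card K ^ (n + 1 + n - 1) :=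
        rationalPointCount_le_totalDegree_mul hΥ'0
    _ = Υ'.totalDegree * Fintype.card K ^ (2 * n) := by
        congr 2; omega

/-! ### Cafure–Matera's Corollary 3.2 -/

open scoped Classical in
/-- **Cafure–Matera (2006), Corollary 3.2 — the plane sections that are not absolutely irreducible
are few.** Let `K = 𝔽_q` and let `f ∈ K[x₀, …, xₙ]` (`n ≥ 1`) be absolutely irreducible of total
degree `δ ≥ 2`. Then the number `B` of parameters `(ν, ω, η) ∈ K^{n+1} × Kⁿ × Kⁿ` for which the
plane section `f_{ν,ω,η} = f(X + ν₀, ωᵢX + ηᵢY + ν_{i+1})` is not absolutely irreducible (its image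
over `K̄` is not irreducible) satisfies `2B + 4δ³ q^{3n} ≤ (3δ⁴ + 5δ²) q^{3n}`, i.e.
`B ≤ (3δ⁴/2 - 2δ³ + 5δ²/2) q^{3n}` ("there exists at most `(3δ⁴/2 − 2δ³ + 5δ²/2) q^{3n−3}` elements
`(ν, ω, η) ∈ 𝔽_q^{3n−2}` for which `χ(X, Y, η)` is not absolutely irreducible", in the paper's
indexing of `n` variables). From Kaltofen's effective Bertini theorem
(`kaltofen1995_effectiveBertini_holds`: `deg Υ ≤ 2δ²`, `2 deg Ψ + 4δ³ ≤ 3δ⁴ + δ²`) and the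
Schwartz–Zippel counts of Lemma 2.1. [cite: CafureMatera2006, Cor. 3.2]
[cite: Kaltofen1995, Lemma 4 and Thm. 5] -/
theorem two_mul_card_filter_not_irreducible_planeSection_add_le {n : ℕ} (hn : 1 ≤ n)
    (f : MvPolynomial (Fin (n + 1)) K) {δ : ℕ} (hδ : 2 ≤ δ) (hdeg : f.totalDegree = δ)
    (hf : IsAbsIrreducible f) :
    2 * ((Finset.univ : Finset ((Fin (n + 1) → K) × (Fin n → K) × (Fin n → K))).filter
        fun p ↦ ¬ Irreducible (MvPolynomial.map (algebraMap K (AlgebraicClosure K))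
          (planeSection f p.1 p.2.1 p.2.2))).card +
      4 * δ ^ 3 * Fintype.card K ^ (3 * n) ≤ (3 * δ ^ 4 + 5 * δ ^ 2) * Fintype.card K ^ (3 * n) := by
  classical
  set Kb := AlgebraicClosure K
  set ι : K →+* Kb := algebraMap K Kb with hι
  set q : ℕ := Fintype.card K with hq
  obtain ⟨Υ, hΥ0, hΥdeg, hΥ⟩ := kaltofen1995_effectiveBertini_holds K n δ f hn hδ hdeg hf
  -- the bad parameters
  set bad : (Fin (n + 1) → K) × (Fin n → K) × (Fin n → K) → Prop := fun p ↦
    ¬ Irreducible (MvPolynomial.map ι (planeSection f p.1 p.2.1 p.2.2)) with hbad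
  -- `Υ(ν, ω)` read over `K̄` is the image of `Υ(ν, ω)` read over `K`
  have hΥeval : ∀ (ν : Fin (n + 1) → K) (ω : Fin n → K),
      MvPolynomial.aeval (Sum.elim (ι ∘ ν) (ι ∘ ω)) Υ = ι (MvPolynomial.eval (Sum.elim ν ω) Υ) := by
    intro ν ω
    have h := MvPolynomial.eval₂_comp_left ι (RingHom.id K) (Sum.elim ν ω) Υ
    rw [RingHom.comp_id] at h
    rw [← Sum.comp_elim, MvPolynomial.aeval_def]
    exact h.symm
  -- the fibre count `b(ν, ω) = #{η : (ν, ω, η) bad}`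
  set b : (Fin (n + 1) → K) × (Fin n → K) → ℕ := fun νω ↦
    ((Finset.univ : Finset (Fin n → K)).filter fun η ↦ bad (νω.1, νω.2, η)).card with hb
  have hL : ((Finset.univ : Finset ((Fin (n + 1) → K) × (Fin n → K) × (Fin n → K))).filter
      bad).card = ∑ ν : Fin (n + 1) → K, ∑ ω : Fin n → K, ∑ η : Fin n → K,
        (if bad (ν, ω, η) then 1 else 0) := by
    rw [Finset.card_filter, Fintype.sum_prod_type]
    refine Finset.sum_congr rfl fun ν _ ↦ ?_
    rw [Fintype.sum_prod_type]
  have hR : ∑ νω : (Fin (n + 1) → K) × (Fin n → K), b νω =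
      ∑ ν : Fin (n + 1) → K, ∑ ω : Fin n → K, ∑ η : Fin n → K, (if bad (ν, ω, η) then 1 else 0) := by
    rw [Fintype.sum_prod_type]
    refine Finset.sum_congr rfl fun ν _ ↦ Finset.sum_congr rfl fun ω _ ↦ ?_
    rw [hb]
    beta_reduce
    rw [Finset.card_filter]
  have hcardB : ((Finset.univ : Finset ((Fin (n + 1) → K) × (Fin n → K) × (Fin n → K))).filter
      bad).card = ∑ νω : (Fin (n + 1) → K) × (Fin n → K), b νω := hL.trans hR.symm
  -- fibres over the zeros of `Υ`: trivial bound
  have hb_triv : ∀ νω, b νω ≤ q ^ n := fun νω ↦ by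
    rw [hb]
    exact (Finset.card_filter_le _ _).trans (by rw [Finset.card_univ, Fintype.card_fun, Fintype.card_fin])
  -- fibres off the zeros of `Υ`: Kaltofen's `Ψ`
  have hb_good : ∀ νω : (Fin (n + 1) → K) × (Fin n → K),
      MvPolynomial.eval (Sum.elim νω.1 νω.2) Υ ≠ 0 →
      2 * b νω + 4 * δ ^ 3 * q ^ (n - 1) ≤ (3 * δ ^ 4 + δ ^ 2) * q ^ (n - 1) := by
    rintro ⟨ν, ω⟩ hne
    have hne' : MvPolynomial.aeval (Sum.elim (ι ∘ ν) (ι ∘ ω)) Υ ≠ 0 := by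
      rw [hΥeval, map_ne_zero_iff ι ι.injective]; exact hne
    obtain ⟨Ψ, hΨ0, hΨdeg, hΨ⟩ := hΥ (ι ∘ ν) (ι ∘ ω) hne'
    have hsub : ((Finset.univ : Finset (Fin n → K)).filter fun η ↦ bad (ν, ω, η)) ⊆
        (Finset.univ.filter fun η ↦ MvPolynomial.eval (ι ∘ η) Ψ = 0) := by
      intro η hη
      rw [Finset.mem_filter] at hη ⊢
      refine ⟨Finset.mem_univ _, ?_⟩
      by_contra hΨη
      apply hη.2
      have hirr := hΨ (ι ∘ η) hΨη
      change Irreducible (MvPolynomial.map ι (planeSection f ν ω η))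
      rw [map_planeSection]
      exact hirr
    have hle : b (ν, ω) ≤ Ψ.totalDegree * q ^ (n - 1) := by
      rw [hb]
      exact (Finset.card_le_card hsub).trans (card_filter_eval_comp_eq_zero_le hn hΨ0)
    have := Nat.mul_le_mul_right (q ^ (n - 1)) hΨdeg
    nlinarith
  -- ### summation
  set U₀ : Finset ((Fin (n + 1) → K) × (Fin n → K)) :=
    Finset.univ.filter fun νω ↦ MvPolynomial.eval (Sum.elim νω.1 νω.2) Υ = 0 with hU₀
  have hU₀card : U₀.card ≤ 2 * δ ^ 2 * q ^ (2 * n) :=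
    (card_filter_eval_sumElim_eq_zero_le hΥ0).trans (Nat.mul_le_mul_right _ hΥdeg)
  have hUcard : (Finset.univ : Finset ((Fin (n + 1) → K) × (Fin n → K))).card = q ^ (2 * n + 1) := by
    rw [Finset.card_univ, Fintype.card_prod, Fintype.card_fun, Fintype.card_fun, Fintype.card_fin,
      Fintype.card_fin, ← pow_add]
    congr 1; omega
  -- fibrewise bound in `ℤ`
  have hfib : ∀ νω : (Fin (n + 1) → K) × (Fin n → K),
      (2 * b νω : ℤ) ≤ if νω ∈ U₀ then 2 * (q : ℤ) ^ n
        else (3 * (δ : ℤ) ^ 4 + δ ^ 2 - 4 * δ ^ 3) * (q : ℤ) ^ (n - 1) := by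
    intro νω
    split_ifs with h
    · have := hb_triv νω
      linarith [show (b νω : ℤ) ≤ (q : ℤ) ^ n by exact_mod_cast this]
    · have hne : MvPolynomial.eval (Sum.elim νω.1 νω.2) Υ ≠ 0 := by
        intro h0; exact h (Finset.mem_filter.2 ⟨Finset.mem_univ _, h0⟩)
      have := hb_good νω hne
      have h' : (2 * b νω + 4 * δ ^ 3 * q ^ (n - 1) : ℤ) ≤ (3 * δ ^ 4 + δ ^ 2) * q ^ (n - 1) := by
        exact_mod_cast this
      linarith
  have hsum : (2 * ∑ νω : (Fin (n + 1) → K) × (Fin n → K), (b νω : ℤ)) ≤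
      U₀.card * (2 * (q : ℤ) ^ n) +
        ((Finset.univ : Finset ((Fin (n + 1) → K) × (Fin n → K))).card - U₀.card : ℤ) *
          ((3 * (δ : ℤ) ^ 4 + δ ^ 2 - 4 * δ ^ 3) * (q : ℤ) ^ (n - 1)) := by
    rw [Finset.mul_sum]
    refine (Finset.sum_le_sum fun νω _ ↦ hfib νω).trans (le_of_eq ?_)
    rw [Finset.sum_ite, Finset.sum_const, Finset.sum_const, nsmul_eq_mul, nsmul_eq_mul]
    have h1 : (Finset.univ.filter fun νω ↦ νω ∈ U₀) = U₀ := by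
      ext νω; simp
    have h2 : ((Finset.univ.filter fun νω : (Fin (n + 1) → K) × (Fin n → K) ↦ νω ∉ U₀).card : ℤ) =
        (Finset.univ : Finset ((Fin (n + 1) → K) × (Fin n → K))).card - U₀.card := by
      have := Finset.card_filter_add_card_filter_not (s := (Finset.univ :
        Finset ((Fin (n + 1) → K) × (Fin n → K)))) (fun νω ↦ νω ∈ U₀)
      rw [h1] at this
      omega
    rw [h1, h2]
  -- ### conclusion
  have hδ34 : 4 * (δ : ℤ) ^ 3 ≤ 3 * (δ : ℤ) ^ 4 := by
    have : (2 : ℤ) ≤ δ := by exact_mod_cast hδ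
    nlinarith [pow_pos (show (0 : ℤ) < δ by omega) 3]
  have hq0 : (0 : ℤ) ≤ q := by positivity
  have hqn : (q : ℤ) ^ (n - 1) * (q : ℤ) ^ (2 * n + 1) = (q : ℤ) ^ (3 * n) := by
    rw [← pow_add]; congr 1; omega
  have hqn' : (q : ℤ) ^ (2 * n) * (q : ℤ) ^ n = (q : ℤ) ^ (3 * n) := by
    rw [← pow_add]; congr 1; omega
  have hqn'' : (q : ℤ) ^ (n - 1) * q = (q : ℤ) ^ n := by
    rw [← pow_succ]; congr 1; omega
  have hU₀' : (U₀.card : ℤ) ≤ 2 * δ ^ 2 * (q : ℤ) ^ (2 * n) := by exact_mod_cast hU₀card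
  have hU' : ((Finset.univ : Finset ((Fin (n + 1) → K) × (Fin n → K))).card : ℤ) = (q : ℤ) ^ (2 * n + 1) := by
    exact_mod_cast hUcard
  have hU₀le : (U₀.card : ℤ) ≤ (q : ℤ) ^ (2 * n + 1) := by
    rw [← hU']; exact_mod_cast Finset.card_le_univ _
  rw [hcardB]
  zify
  rw [hU'] at hsum
  -- `2 ∑ b ≤ #U₀ · 2qⁿ + (q^{2n+1} - #U₀) c q^{n-1}` with `c = 3δ⁴ + δ² - 4δ³ ≥ 0`
  have hc0 : (0 : ℤ) ≤ (3 * (δ : ℤ) ^ 4 + δ ^ 2 - 4 * δ ^ 3) * (q : ℤ) ^ (n - 1) :=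
    mul_nonneg (by nlinarith) (by positivity)
  -- the coefficient of `#U₀` is `2qⁿ - c q^{n-1} ≤ 2 qⁿ`, and `#U₀ ≤ 2δ² q^{2n}`
  have key : (U₀.card : ℤ) * (2 * (q : ℤ) ^ n) +
      ((q : ℤ) ^ (2 * n + 1) - U₀.card) * ((3 * (δ : ℤ) ^ 4 + δ ^ 2 - 4 * δ ^ 3) * (q : ℤ) ^ (n - 1)) ≤
      2 * δ ^ 2 * (q : ℤ) ^ (2 * n) * (2 * (q : ℤ) ^ n) +
        (q : ℤ) ^ (2 * n + 1) * ((3 * (δ : ℤ) ^ 4 + δ ^ 2 - 4 * δ ^ 3) * (q : ℤ) ^ (n - 1)) := by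
    nlinarith [mul_nonneg (sub_nonneg.2 hU₀le) hc0, mul_le_mul_of_nonneg_right hU₀'
      (show (0:ℤ) ≤ 2 * (q : ℤ) ^ n by positivity)]
  have hfinal : (2 * ∑ νω : (Fin (n + 1) → K) × (Fin n → K), (b νω : ℤ)) + 4 * δ ^ 3 * (q : ℤ) ^ (3 * n) ≤
      (3 * δ ^ 4 + 5 * δ ^ 2) * (q : ℤ) ^ (3 * n) := by
    have h := hsum.trans key
    have e1 : 2 * (δ : ℤ) ^ 2 * (q : ℤ) ^ (2 * n) * (2 * (q : ℤ) ^ n) = 4 * δ ^ 2 * (q : ℤ) ^ (3 * n) := by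
      rw [← hqn']; ring
    have e2 : (q : ℤ) ^ (2 * n + 1) * ((3 * (δ : ℤ) ^ 4 + δ ^ 2 - 4 * δ ^ 3) * (q : ℤ) ^ (n - 1)) =
        (3 * (δ : ℤ) ^ 4 + δ ^ 2 - 4 * δ ^ 3) * (q : ℤ) ^ (3 * n) := by
      rw [← hqn]; ring
    rw [e1, e2] at h
    nlinarith
  convert hfinal using 2

end Literature.NumberTheory.DiophantineGeometry

end
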